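import Summits.BirchSwinnertonDyer.BirchSwinnertonDyer.Theorems.Rank2Observatory2DescKill
import Summits.BirchSwinnertonDyer.BirchSwinnertonDyer.Theorems.Rank2Observatory2DescLinGens
import HarnessLib

/-!
# BirchSwinnertonDyer — rank ≥ 2 observatory: KERNEL-2DESC v1.3c, a LIST of killed classes (multi-kill sieve)

HONEST FRAMING: per-curve certified theorems and census instruments; no claim on BSD in rank ≥ 2.

Generic layer C of the kill instrument (design `b2b-bsdr2-cert-3/KERNEL-2DESC.md` §11): on top of
`Rank2Observatory2DescKillCheck` (the residue-insolubility check `killCheck` of one `2`-covering) and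
`Rank2Observatory2DescKill` (`admKill`, `not_isSquare_of_killCheck`, the strict count
`mordellWeilRank_le_of_coverSet_lt`), this file lets a per-curve file remove SEVERAL classes of
`K(S, 2)` at once from the sieve-admissible set with ONE kernel-evaluated Boolean certificate:

* `KillEntry m s` — one killed class: unit exponents `T ⊆ Fin m`, generator exponents `U ⊆ Fin s`, the
  power-basis coordinates `z` of the class representative `∏_{i∈T} uᵢ · ∏_{j∈U} Gⱼ`, a prime `p` and a fuel;
* `prodCoords` — the coordinates of that representative computed in `ℤ³` by the structure constants
  (`TwoDescKill.mul3`), from the coordinate vectors `cu`, `cg` of the units and generators;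
* `killListCheck a b c t₁ t₂ cu cg L` — for every entry: `p ∈ killPrimes` (`2 … 23`), `prodCoords = z`,
  `z ≠ 0`, and `killCheck p a b c z t₁ t₂ fuel`; all decidable, evaluated by `decide` in the kernel;
* `admKills adm L` — the sieve "admissible and none of the listed classes";
* `admKills_sound` — if the list certificate holds, every class met by a rational point passes `admKills`
  (each listed class is excluded by `not_isSquare_of_killCheck`); `admKills_empty` — the trivial class passes.

With `16` admissible classes (tier 2 of the instrument) and `k ≥ 9` listed kills, `16 − k < 2³` and
`mordellWeilRank_le_of_coverSet_lt` gives `rank ≤ 2`. Sorry-free; axioms `propext`, `Classical.choice`,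
`Quot.sound`. [cite: Cassels1991LecturesEllipticCurves, §15] [cite: CremonaAlgorithms1997, §3.6]
-/

-- single-conjunct summit: `Summit.BirchSwinnertonDyer.BirchSwinnertonDyer.…` repeats the name by design
set_option linter.dupNamespace false

open scoped NumberField

open Literature.NumberTheory.NumberFields Polynomial Module NumberField

namespace Summit.BirchSwinnertonDyer.BirchSwinnertonDyer.Rank2Observatory.TwoDescCubic

open TwoDescKill

variable {K : Type*} [Field K] [NumberField K] {a b c : ℤ} {α : K}

/-- The element of `K` with power-basis coordinates `u ∈ ℤ³`. [folklore] -/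
def evZ (α : K) (u : ℤ × ℤ × ℤ) : K := (u.1 : K) + (u.2.1 : K) * α + (u.2.2 : K) * α ^ 2

omit [NumberField K] in
/-- `evZ` is multiplicative with respect to `mul3` (uses `α³ = −aα² − bα − c`). [folklore] -/
theorem evZ_mul3 (hrel : α ^ 3 + (a : K) * α ^ 2 + (b : K) * α + (c : K) = 0) (u v : ℤ × ℤ × ℤ) :
    evZ α (mul3 a b c u v) = evZ α u * evZ α v := by
  obtain ⟨u₀, u₁, u₂⟩ := u
  obtain ⟨v₀, v₁, v₂⟩ := v
  simp only [evZ, mul3]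
  push_cast
  linear_combination (-(((u₁ : K) * v₂ + u₂ * v₁) + (u₂ : K) * v₂ * (α - a))) * hrel

omit [NumberField K] in
/-- `evZ` of a `lin` form. [folklore] -/
theorem algebraMap_lin_evZ (hα : aeval α (MonicCubic.poly a b c) = 0) (u : ℤ × ℤ × ℤ) :
    algebraMap (𝓞 K) K (lin hα u.1 u.2.1 u.2.2) = evZ α u := by
  rw [algebraMap_lin]; rfl

/-- Product of a list of coordinate triples (structure constants of `ℤ[α]`). [folklore] -/
def coordsProd (a b c : ℤ) : List (ℤ × ℤ × ℤ) → ℤ × ℤ × ℤ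
  | [] => (1, 0, 0)
  | u :: l => mul3 a b c u (coordsProd a b c l)

omit [NumberField K] in
/-- `evZ (coordsProd l) = ∏ evZ`. [folklore] -/
theorem evZ_coordsProd (hrel : α ^ 3 + (a : K) * α ^ 2 + (b : K) * α + (c : K) = 0)
    (l : List (ℤ × ℤ × ℤ)) : evZ α (coordsProd a b c l) = (l.map (evZ α)).prod := by
  induction l with
  | nil => simp [coordsProd, evZ]
  | cons u l ih => rw [coordsProd, evZ_mul3 hrel, ih, List.map_cons, List.prod_cons]

omit [NumberField K] in
/-- A `Finset` product of elements with known coordinates is `evZ` of the coordinate product over the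
filtered `finRange` list. [folklore] -/
theorem prod_eq_evZ (hrel : α ^ 3 + (a : K) * α ^ 2 + (b : K) * α + (c : K) = 0) {n : ℕ}
    (S : Finset (Fin n)) (cv : Fin n → ℤ × ℤ × ℤ) (f : Fin n → K) (hf : ∀ i, f i = evZ α (cv i)) :
    ∏ i ∈ S, f i = evZ α (coordsProd a b c (((List.finRange n).filter (· ∈ S)).map cv)) := by
  classical
  rw [show f = evZ α ∘ cv from funext hf, evZ_coordsProd hrel, List.map_map]
  have hnd : ((List.finRange n).filter (· ∈ S)).Nodup := (List.nodup_finRange n).filter _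
  have hS : ((List.finRange n).filter (· ∈ S)).toFinset = S := by
    ext i; simp
  conv_lhs => rw [← hS]
  rw [List.prod_toFinset _ hnd]

/-- Power-basis coordinates of the class representative `∏_{i∈T} uᵢ · ∏_{j∈U} Gⱼ`, from the coordinate
vectors `cu` (units) and `cg` (generators). [folklore] -/
def prodCoords (a b c : ℤ) {m : ℕ} (cu : Fin m → ℤ × ℤ × ℤ) {s : ℕ} (cg : Fin s → ℤ × ℤ × ℤ)
    (T : Finset (Fin m)) (U : Finset (Fin s)) : ℤ × ℤ × ℤ :=
  mul3 a b c (coordsProd a b c (((List.finRange m).filter (· ∈ T)).map cu))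
    (coordsProd a b c (((List.finRange s).filter (· ∈ U)).map cg))

/-- One killed class: exponent sets, representative coordinates, prime, fuel. [folklore] -/
structure KillEntry (m s : ℕ) where
  /-- unit exponents -/
  T : Finset (Fin m)
  /-- generator exponents -/
  U : Finset (Fin s)
  /-- power-basis coordinates of the class representative -/
  z : ℤ × ℤ × ℤ
  /-- the prime of the residue-insolubility certificate -/
  p : ℕ
  /-- search fuel (`depth − 1`) -/
  fuel : ℕ

/-- The primes a kill certificate may use (their residue searches fit the kernel budget). [folklore] -/
def killPrimes : List ℕ := [2, 3, 5, 7, 11, 13, 17, 19, 23]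

/-- Every listed prime is prime. [folklore] -/
theorem prime_of_mem_killPrimes {p : ℕ} (h : p ∈ killPrimes) : p.Prime := by
  simp only [killPrimes, List.mem_cons, List.not_mem_nil, or_false] at h
  rcases h with rfl | rfl | rfl | rfl | rfl | rfl | rfl | rfl | rfl <;> norm_num

/-- **The list certificate**: for each entry, `p ∈ killPrimes`, the coordinates multiply out to `z`,
`z ≠ 0`, and the residue search `killCheck` succeeds. Evaluated by `decide`. [cite: CremonaAlgorithms1997, §3.6] -/
def killListCheck (a b c t₁ t₂ : ℤ) {m : ℕ} (cu : Fin m → ℤ × ℤ × ℤ) {s : ℕ} (cg : Fin s → ℤ × ℤ × ℤ)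
    (L : List (KillEntry m s)) : Bool :=
  L.all fun e => decide (e.p ∈ killPrimes) && decide (prodCoords a b c cu cg e.T e.U = e.z) &&
    decide (e.z ≠ ((0 : ℤ), (0 : ℤ), (0 : ℤ))) && killCheck e.p a b c e.z t₁ t₂ e.fuel

/-- The sieve "admissible, and none of the listed (killed) classes". [folklore] -/
def admKills {m s : ℕ} (adm : Finset (Fin m) → Finset (Fin s) → Bool) (L : List (KillEntry m s))
    (T : Finset (Fin m)) (U : Finset (Fin s)) : Bool :=
  adm T U && decide (∀ e ∈ L, ¬ (T = e.T ∧ U = e.U))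

/-- The trivial class passes `admKills` when it is admissible and not listed. [folklore] -/
theorem admKills_empty {m s : ℕ} {adm : Finset (Fin m) → Finset (Fin s) → Bool}
    {L : List (KillEntry m s)} (h0 : adm ∅ ∅ = true)
    (hL : (L.all fun e => !(decide (e.T = ∅) && decide (e.U = ∅))) = true) :
    admKills adm L ∅ ∅ = true := by
  simp only [admKills, h0, Bool.true_and, decide_eq_true_eq]
  intro e he ⟨hT, hU⟩
  have := List.all_eq_true.mp hL e he
  simp [← hT, ← hU] at this

/-- **Soundness of the multi-kill sieve.** If the list certificate holds for the coordinate data of the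
units `u` and generators `G`, then a class `(T, U)` met by a rational point (the `IsSquare` hypothesis of
the `2`-descent map) is admissible and is none of the listed classes: a listed class would make
`(x − θ)·z` a square in `K`, excluded by `not_isSquare_of_killCheck`. [cite: Cassels1991LecturesEllipticCurves, §15] -/
theorem admKills_sound (hirr : Irreducible (MonicCubic.polyQ a b c))
    (hα : aeval α (MonicCubic.poly a b c) = 0) (h3 : finrank ℚ K = 3)
    (t₀ : ℤ) {t₁ t₂ : ℤ} {m s : ℕ} (u : Fin m → 𝓞 K) (G : Fin s → 𝓞 K)
    {cu : Fin m → ℤ × ℤ × ℤ} {cg : Fin s → ℤ × ℤ × ℤ}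
    (hu : ∀ i, u i = lin hα (cu i).1 (cu i).2.1 (cu i).2.2)
    (hG : ∀ j, G j = lin hα (cg j).1 (cg j).2.1 (cg j).2.2)
    {L : List (KillEntry m s)} (hL : killListCheck a b c t₁ t₂ cu cg L = true)
    {adm : Finset (Fin m) → Finset (Fin s) → Bool} {T : Finset (Fin m)} {U : Finset (Fin s)}
    (hadm : adm T U = true) (x : ℚ)
    (hsq : IsSquare ((algebraMap ℚ K x - algebraMap (𝓞 K) K (lin hα t₀ t₁ t₂)) *
      (∏ i ∈ T, algebraMap (𝓞 K) K (u i)) * ∏ j ∈ U, algebraMap (𝓞 K) K (G j))) :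
    admKills adm L T U = true := by
  classical
  simp only [admKills, hadm, Bool.true_and, decide_eq_true_eq]
  rintro e he ⟨rfl, rfl⟩
  have hrel := MonicCubic.theta_rel hα
  have he' := List.all_eq_true.mp hL e he
  simp only [Bool.and_eq_true, decide_eq_true_eq] at he'
  obtain ⟨⟨⟨hp, hz⟩, hz0⟩, hk⟩ := he'
  rw [prod_eq_evZ hrel e.T cu _ (fun i => by rw [hu, algebraMap_lin_evZ]),
    prod_eq_evZ hrel e.U cg _ (fun j => by rw [hG, algebraMap_lin_evZ]), mul_assoc,
    ← evZ_mul3 hrel, algebraMap_lin] at hsq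
  change IsSquare (_ * evZ α (prodCoords a b c cu cg e.T e.U)) at hsq
  rw [hz] at hsq
  obtain ⟨T', U', ⟨z₀, z₁, z₂⟩, p, fuel⟩ := e
  exact not_isSquare_of_killCheck hirr hα h3 (prime_of_mem_killPrimes hp) t₀ hk hz0 x hsq

end Summit.BirchSwinnertonDyer.BirchSwinnertonDyer.Rank2Observatory.TwoDescCubic
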